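import Mathlib
import Literature.NumberTheory.Transcendental.ZagierDilogarithmConjecture
import Literature.NumberTheory.Transcendental.BlochWignerDilogarithm
import Literature.NumberTheory.LFunctions.DirichletLValueBernoulli
import Summits.KontsevichZagierPeriods.KontsevichZagierPeriods.Theorems.HyperbolicBlochZagierDilogarithmConjectureStubClausenCharSumPrimitive
import Summits.KontsevichZagierPeriods.KontsevichZagierPeriods.Theorems.HyperbolicBlochZagierDilogarithmConjectureStubClausenCharSumLevel
import Summits.KontsevichZagierPeriods.KontsevichZagierPeriods.Theorems.HyperbolicBlochZagierDilogarithmConjectureStubClausenCharSumNeZero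
import Summits.KontsevichZagierPeriods.KontsevichZagierPeriods.Theorems.HyperbolicBlochZagierDilogarithmConjectureStubCyclotomicTwists
import Summits.KontsevichZagierPeriods.KontsevichZagierPeriods.Theorems.HyperbolicBlochZagierDilogarithmConjectureStubOddFourierInversion
import HarnessLib

/-!
# `ZagierDilogarithmConjecture` (stmt-KontsevichZagierPeriods-10550) — line
`kummer-clausen-linearisation` (reshape c4, "the cyclotomic sector, exactly"), stub
`stub_cyclotomicIndependence` (the lead's)

**Cyclotomic independence modulo the dilogarithm relators — UNCONDITIONAL.** Let `ζ_N = e^{2πi/N}`,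
`D` the Bloch–Wigner dilogarithm and `⟨dilogRelators⟩` the subgroup of `ℤ[ℂ]` generated by the five-term
relators over `ℚ̄`, the conjugation pairs `[w] + [w̄]` (`w` algebraic) and the real points `[w]` — the
relator group of Zagier's dilogarithm conjecture (Neumann 1998, §2.1). For every `N` and every
`m : ℤ/N → ℤ` supported on the primitive residues of the open upper half (`(c, N) = 1`, `0 < c < N/2`):

  `Σ_c m_c [ζ_N^c] ∈ ⟨dilogRelators⟩  ⟹  m = 0`.

So the relator group meets the primitive `N`-th roots of unity of `ℍ⁺` in NO relation at all: the
conclusion of Zagier's conjecture is as non-vacuous as possible on the cyclotomic Bloch part (where the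
Dehn invariant is blind), and any proof of the conjecture proves Milnor's conjecture on the `ℚ`-linear
independence of the Clausen values `Cl₂(2πc/N) = D(ζ_N^c)`, `(c, N) = 1`, `0 < c < N/2` (skeleton
`crux_implies_milnor`). No appeal to Borel's theorem: the tool is the family of Clausen character sums
`Λ_N(χ) = Σ_{c mod N} χ(c) D(ζ_N^c)`, non-zero for every odd Dirichlet character `χ`
(`clausenCharSum_ne_zero`: primitive case `−i·W(χ)·L(2, χ⁻¹)` — Gauss sum and `L(2, χ⁻¹)` are non-zero —
and level raising `Λ_{Mp}(χ↑) = (1/p − χ(p))·Λ_M(χ)` by the distribution relations of `D`).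

Proof. (1) `stub_cyclotomicTwists`: the Galois twists `ζ ↦ ζᵃ` give `Σ_c m_c D(ζ^{ac}) = 0` for every
unit `a`. (2) Pair with an odd `χ` and substitute `b = ac`:
`0 = Σ_a χ⁻¹(a) Σ_c m_c D(ζ^{ac}) = Λ_N(χ⁻¹) · Σ_c m_c χ(c)`, so `Σ_c m_c χ(c) = 0` for every odd `χ`.
(3) The odd function `f(u) = m_u − m_{−u}` on `(ℤ/N)ˣ` then pairs to zero with every odd character, so
`f = 0` (`stub_oddFourierInversion`): `m_c = m_{−c}` for all units `c`. (4) If `0 < c < N/2` then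
`−c ≡ N − c` lies in the lower half, outside the support: `m_c = m_{−c} = 0`.
Sorry-free; axioms ⊆ {propext, Classical.choice, Quot.sound}.
[cite: Neumann1998, §2.1] [cite: Milnor1982, Appendix]
-/

noncomputable section

open scoped BigOperators ComplexConjugate
open Literature.NumberTheory.Transcendental

namespace Summit.KontsevichZagierPeriods.HyperbolicBloch.ZagierDilogarithmCyclotomic

/-! ### The Clausen character sums are non-zero (all odd characters, unconditionally) -/

/-- **Primitive case.** For a primitive odd Dirichlet character `χ mod N`,
`Σ_{c mod N} χ(c) D(ζ_N^c) = −i · W(χ) · L(2, χ⁻¹) ≠ 0`: the Gauss sum of a primitive character and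
`L(2, χ⁻¹)` do not vanish. [cite: Apostol1976, Thm. 8.15] -/
theorem clausenCharSum_primitive_ne_zero (N : ℕ) [NeZero N] (χ : DirichletCharacter ℂ N)
    (hχ : χ.IsPrimitive) (hodd : χ.Odd) :
    (∑ c : ZMod N, χ c *
        (blochWignerDilog (Complex.exp (2 * Real.pi * Complex.I / N) ^ c.val) : ℂ)) ≠ 0 := by
  rw [stub_clausenCharSumPrimitive N χ hχ hodd]
  refine neg_ne_zero.2 (mul_ne_zero (mul_ne_zero Complex.I_ne_zero
    (Literature.NumberTheory.LFunctions.gaussSum_ne_zero χ hχ)) ?_)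
  have h := Literature.NumberTheory.LFunctions.LFunction_natCast_ne_zero χ⁻¹ (k := 2) le_rfl
  simpa using h

/-- **All odd characters.** For every odd Dirichlet character `χ mod N` (`N ≥ 1`),
`Λ_N(χ) = Σ_{c mod N} χ(c) D(ζ_N^c) ≠ 0` — primitive case plus level raising, by induction over
the level (`stub_clausenCharSum_ne_zero`). [folklore] -/
theorem clausenCharSum_ne_zero (N : ℕ) [NeZero N] (χ : DirichletCharacter ℂ N) (hodd : χ.Odd) :
    (∑ c : ZMod N, χ c *
        (blochWignerDilog (Complex.exp (2 * Real.pi * Complex.I / N) ^ c.val) : ℂ)) ≠ 0 :=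
  stub_clausenCharSum_ne_zero
    (fun M hM ψ hψ hψodd => @clausenCharSum_primitive_ne_zero M hM ψ hψ hψodd)
    (fun M p hM hMp hp ψ => @stub_clausenCharSumLevel M p hM hMp hp ψ) N χ hodd

/-! ### Bookkeeping on `ℤ/N`: units versus all residues -/

namespace CyclotomicIndependence

variable {N : ℕ} [NeZero N]

/-- A sum over `ℤ/N` of a function vanishing off the units is the sum over the units. [folklore] -/
theorem sum_units_eq_sum (g : ZMod N → ℂ) (hg : ∀ c, ¬IsUnit c → g c = 0) :
    ∑ u : (ZMod N)ˣ, g u = ∑ c : ZMod N, g c := by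
  classical
  rw [← Finset.sum_filter_of_ne (p := IsUnit) (s := (Finset.univ : Finset (ZMod N)))
    (fun c _ hc => by by_contra h; exact hc (hg c h))]
  refine Finset.sum_bij (fun u _ => (u : ZMod N)) (fun u _ => by simp) (fun u _ v _ h => Units.ext h)
    (fun b hb => ?_) (fun u _ => rfl)
  obtain ⟨-, hb⟩ := Finset.mem_filter.1 hb
  exact ⟨hb.unit, Finset.mem_univ _, hb.unit_spec⟩

/-- A Dirichlet character kills the non-units, so `Σ_{u unit} F(u) χ(u) = Σ_{c mod N} F(c) χ(c)`.
[folklore] -/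
theorem sum_units_mul_char (F : ZMod N → ℂ) (χ : DirichletCharacter ℂ N) :
    ∑ u : (ZMod N)ˣ, F u * χ u = ∑ c : ZMod N, F c * χ c :=
  sum_units_eq_sum (fun c => F c * χ c) fun c hc => by rw [MulChar.map_nonunit χ hc, mul_zero]

/-- Substituting `b = a·u` (`u` a unit): `Σ_a χ(a) G(a·u) = χ(u⁻¹) Σ_b χ(b) G(b)`. [folklore] -/
theorem sum_char_mul_shift (χ : DirichletCharacter ℂ N) (G : ZMod N → ℂ) (u : (ZMod N)ˣ) :
    ∑ a : ZMod N, χ a * G (a * u) = χ (↑u⁻¹ : ZMod N) * ∑ b : ZMod N, χ b * G b := by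
  rw [Finset.mul_sum]
  refine Fintype.sum_equiv (Units.mulRight u) _ _ fun a => ?_
  simp only [Units.mulRight_apply]
  rw [← mul_assoc, ← map_mul,
    show (↑u⁻¹ : ZMod N) * (a * ↑u) = a by rw [mul_left_comm, Units.inv_mul, mul_one]]

omit [NeZero N] in
/-- For a unit `u` of `ℤ/N`: `χ(u⁻¹) = χ⁻¹(u)`. [folklore] -/
theorem char_units_inv (χ : DirichletCharacter ℂ N) (u : (ZMod N)ˣ) :
    χ (↑u⁻¹ : ZMod N) = χ⁻¹ (u : ZMod N) := by
  rw [MulChar.inv_apply_eq_inv', map_units_inv]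

/-- The value of `−u` for a non-zero residue: `(−c).val = N − c.val`. [folklore] -/
theorem val_neg_of_ne_zero {c : ZMod N} (hc : c ≠ 0) : (-c).val = N - c.val := by
  rw [ZMod.neg_val, if_neg hc]

end CyclotomicIndependence

open CyclotomicIndependence

/-! ### Step 2: pairing the Galois twists with odd characters -/

/-- If `m` is supported on units and all Galois-twisted volumes `Σ_c m_c D(ζ^{ac})` (`a` a unit)
vanish, then `Σ_c m_c χ(c) = 0` for every ODD Dirichlet character `χ mod N`: pairing the twists with
`χ⁻¹` gives `Λ_N(χ⁻¹) · Σ_c m_c χ(c) = 0`, and `Λ_N(χ⁻¹) ≠ 0`. [folklore] -/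
theorem sum_mul_char_eq_zero_of_twists {N : ℕ} [NeZero N] (m : ZMod N → ℤ)
    (hsupp : ∀ c, m c ≠ 0 → IsUnit c)
    (htw : ∀ a : (ZMod N)ˣ, ∑ c : ZMod N, (m c : ℝ) *
      blochWignerDilog (Complex.exp (2 * Real.pi * Complex.I / N) ^ ((a : ZMod N) * c).val) = 0)
    (χ : DirichletCharacter ℂ N) (hodd : χ.Odd) :
    ∑ c : ZMod N, (m c : ℂ) * χ c = 0 := by
  classical
  set ζ : ℂ := Complex.exp (2 * Real.pi * Complex.I / N) with hζ
  set ψ : DirichletCharacter ℂ N := χ⁻¹ with hψ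
  have hψodd : ψ.Odd := inv_odd χ hodd
  -- the twisted volumes, cast to `ℂ`
  have htw' : ∀ a : (ZMod N)ˣ,
      ∑ c : ZMod N, (m c : ℂ) * (blochWignerDilog (ζ ^ ((a : ZMod N) * c).val) : ℂ) = 0 := by
    intro a
    have h := congrArg (fun r : ℝ => (r : ℂ)) (htw a)
    simpa [Complex.ofReal_sum, Complex.ofReal_mul] using h
  -- `T := Σ_a ψ(a) · (twisted volume at a) = 0`
  have hT : ∑ a : ZMod N, ψ a *
      ∑ c : ZMod N, (m c : ℂ) * (blochWignerDilog (ζ ^ (a * c).val) : ℂ) = 0 := by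
    refine Finset.sum_eq_zero fun a _ => ?_
    by_cases ha : IsUnit a
    · have h := htw' ha.unit
      rw [IsUnit.unit_spec] at h
      rw [h, mul_zero]
    · rw [MulChar.map_nonunit ψ ha, zero_mul]
  -- swap the sums
  have hswap : ∑ a : ZMod N, ψ a *
      ∑ c : ZMod N, (m c : ℂ) * (blochWignerDilog (ζ ^ (a * c).val) : ℂ) =
      ∑ c : ZMod N, (m c : ℂ) * ∑ a : ZMod N, ψ a * (blochWignerDilog (ζ ^ (a * c).val) : ℂ) := by
    simp only [Finset.mul_sum]
    rw [Finset.sum_comm]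
    refine Finset.sum_congr rfl fun c _ => Finset.sum_congr rfl fun a _ => ?_
    ring
  -- evaluate the inner character sums: `m_c · Σ_a ψ(a) D(ζ^{ac}) = Λ(ψ) · m_c · χ(c)`
  have hinner : ∀ c : ZMod N,
      (m c : ℂ) * ∑ a : ZMod N, ψ a * (blochWignerDilog (ζ ^ (a * c).val) : ℂ) =
        (∑ b : ZMod N, ψ b * (blochWignerDilog (ζ ^ b.val) : ℂ)) * ((m c : ℂ) * χ c) := by
    intro c
    by_cases hmc : m c = 0
    · simp [hmc]
    · have hc : IsUnit c := hsupp c hmc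
      have h := sum_char_mul_shift ψ (fun b => (blochWignerDilog (ζ ^ b.val) : ℂ)) hc.unit
      simp only [IsUnit.unit_spec] at h
      rw [h, char_units_inv ψ hc.unit, hψ, inv_inv, IsUnit.unit_spec]
      ring
  have hkey : (∑ b : ZMod N, ψ b * (blochWignerDilog (ζ ^ b.val) : ℂ)) *
      ∑ c : ZMod N, (m c : ℂ) * χ c = 0 := by
    rw [Finset.mul_sum, ← Finset.sum_congr rfl fun c _ => hinner c, ← hswap]
    exact hT
  rcases mul_eq_zero.1 hkey with h | h
  · exact absurd h (clausenCharSum_ne_zero N ψ hψodd)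
  · exact h

/-! ### Steps 3–4: Fourier inversion for the odd part, and the support argument -/

/-- **Stub `stub_cyclotomicIndependence` (the lead's): cyclotomic independence modulo the dilogarithm
relators, UNCONDITIONALLY.** A `ℤ`-combination of the classes `[ζ_N^c]` of primitive `N`-th roots of
unity of the open upper half plane (`(c, N) = 1`, `0 < c < N/2`) lying in `⟨dilogRelators⟩` is zero.
[cite: Neumann1998, §2.1] -/
theorem stub_cyclotomicIndependence :
    ∀ (N : ℕ) [NeZero N] (m : ZMod N → ℤ), (∀ c, m c ≠ 0 → IsUnit c ∧ 0 < c.val ∧ 2 * c.val < N) →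
      (∑ c : ZMod N, m c • FreeAbelianGroup.of (Complex.exp (2 * Real.pi * Complex.I / N) ^ c.val)) ∈
          AddSubgroup.closure dilogRelators →
        ∀ c, m c = 0 := by
  intro N _ m hsupp hmem
  classical
  -- Step 1: the Galois twists
  have htw := stub_cyclotomicTwists N m hmem
  -- Step 2: all odd-character pairings of `m` vanish
  have hpair : ∀ χ : DirichletCharacter ℂ N, χ.Odd → ∑ c : ZMod N, (m c : ℂ) * χ c = 0 :=
    fun χ hχ => sum_mul_char_eq_zero_of_twists m (fun c hc => (hsupp c hc).1) htw χ hχ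
  -- Step 3: the odd function `f(u) = m_u − m_{−u}` on the units vanishes
  set f : (ZMod N)ˣ → ℂ := fun u => (m u : ℂ) - (m (↑(-u) : ZMod N) : ℂ) with hf
  have hfodd : ∀ u, f (-u) = -f u := by
    intro u
    simp only [hf, neg_neg]
    ring
  have hfpair : ∀ χ : DirichletCharacter ℂ N, χ.Odd → ∑ u : (ZMod N)ˣ, f u * χ u = 0 := by
    intro χ hχ
    have h1 : ∑ u : (ZMod N)ˣ, (m u : ℂ) * χ u = 0 := by
      rw [sum_units_mul_char (fun c => (m c : ℂ)) χ]
      exact hpair χ hχ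
    have h2 : ∑ u : (ZMod N)ˣ, (m (↑(-u) : ZMod N) : ℂ) * χ u = 0 := by
      have e : ∑ u : (ZMod N)ˣ, (m (↑(-u) : ZMod N) : ℂ) * χ u =
          ∑ u : (ZMod N)ˣ, -((m (u : ZMod N) : ℂ) * χ u) := by
        refine Fintype.sum_equiv (Equiv.neg _) _ _ fun u => ?_
        simp only [Equiv.neg_apply, Units.val_neg]
        rw [hχ.eval_neg]
        ring
      rw [e, Finset.sum_neg_distrib, h1, neg_zero]
    simp only [hf, sub_mul, Finset.sum_sub_distrib, h1, h2, sub_zero]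
  have hf0 := stub_oddFourierInversion N f hfodd hfpair
  -- Step 4: the support argument
  intro c
  by_contra hc
  obtain ⟨hcu, hc0, hc2⟩ := hsupp c hc
  have hcne : c ≠ 0 := fun h => by rw [h, ZMod.val_zero] at hc0; exact lt_irrefl 0 hc0
  -- `m_c = m_{−c}`
  have heq : (m c : ℂ) = (m (-c) : ℂ) := by
    have h := hf0 hcu.unit
    simp only [hf, Units.val_neg, IsUnit.unit_spec, sub_eq_zero] at h
    exact h
  have heq' : m c = m (-c) := by exact_mod_cast heq
  -- `−c` lies in the lower half, outside the support
  have hneg : m (-c) = 0 := by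
    by_contra h
    obtain ⟨-, -, h2⟩ := hsupp (-c) h
    rw [val_neg_of_ne_zero hcne] at h2
    have hlt : c.val < N := ZMod.val_lt c
    omega
  exact hc (heq'.trans hneg)

end Summit.KontsevichZagierPeriods.HyperbolicBloch.ZagierDilogarithmCyclotomic

end
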